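import Literature.Analysis.FluidPDE.OneComponentEnstrophyProduction
import Literature.Analysis.FluidPDE.OneComponentSliceBounds
import Literature.Analysis.FluidPDE.OneComponentSliceAlgebra
import HarnessLib

/-!
# One-component regularity: the slice estimate (Lemarié-Rieusset 2016, §11.5, proof of Prop. 11.5, (11.26)–(11.30))

Analysis/FluidPDE proof file (theorems only: no definition, no named fact, no `sorry`).
Search for candidate a priori estimates; no regularity claim (cell `pub-nsfunc`, literature seat:
this file formalises a PUBLISHED computation; nothing new). Fifth brick of the discharge of the
named fact `Literature.Analysis.FluidPDE.oneComponentGradientCriterion`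
(`GradientRegularityCriteria.lean`; P. G. Lemarié-Rieusset, *The Navier–Stokes Problem in the
21st Century* (2016), §11.5 Prop. 11.5, PDF pp. 354–357). For one classical slice `v = u(t)`,
`W = ∂ₜu(t)`, `q = p(t)` of a solution of the Navier–Stokes equations (momentum equation and
vorticity equation as hypotheses), with `∇v₃ ∈ L^r`, `2 < r ≤ 6`, the two balances
`R_I = ∫Σᵢ⟪∂ᵢv,∂ᵢW⟫` (`OneComponentEnstrophyProduction`) and `R_G = ∫ω₃(curl W)₃`
(`OneComponentVorticityBalance`), the slice bounds of `OneComponentSliceBounds` and the tree's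
weighted key estimate `integral_weight_mul_sq_norm_fderiv_apply_le`, fed into the real-variable
bookkeeping `oneComponent_slice_algebra`, give the differential inequality of the functional
`1 + ‖∇u‖₂² + ‖ω₃‖₂⁴`:

`R_I + 2 ‖ω₃‖₂² R_G ≤ C (1 + ‖∇v₃‖_r^q + ‖∇v‖₂²) (1 + ‖∇v‖₂² + ‖ω₃‖₂⁴)`, `q = 4r/(3r-6)`.

* `oneComponent_slice_le` — the slice estimate, with an existential constant depending on `ν`
  and `r` only.

## References

* [LemarieRieusset2016] P. G. Lemarié-Rieusset, *The Navier–Stokes Problem in the 21st Century*,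
  CRC Press 2016, §11.5, proof of Prop. 11.5, (11.26)–(11.30) (held text, PDF pp. 355–356).
* [Zhou2002] Y. Zhou, *A new regularity criterion for the Navier–Stokes equations in terms of the
  gradient of one velocity component*, Methods Appl. Anal. 9 (2002) 563–578.
-/

noncomputable section

open MeasureTheory Set Function Filter Topology InnerProductSpace
open Literature.Analysis.FunctionSpaces
open scoped ENNReal NNReal ContDiff RealInnerProductSpace Laplacian

namespace Literature.Analysis.FluidPDE

section Slice

/-- **The slice estimate of the one-component criterion** (Lemarié-Rieusset 2016, proof of
Prop. 11.5, (11.26)–(11.30)). For `ν > 0` and `2 < r ≤ 6` there is `C ≥ 0` such that for every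
smooth, bounded (with two bounded derivatives), divergence-free `v : ℝ³ → ℝ³` with
`v, Dv, D²v, D³v ∈ L²`, every `C¹` fields `W`, `q` with `W, DW, q, Dq ∈ L²`, the momentum
equation `W + (v·∇)v = νΔv - ∇q` and the vorticity equation
`curl W = νΔω - (v·∇)ω + (ω·∇)v`, and `∇v₃ ∈ L^r`:
`R_I + 2 G R_G ≤ C (1 + N^q + E) (1 + E + G²)`, where `R_I = ∫Σᵢ⟪∂ᵢv, ∂ᵢW⟫`,
`R_G = ∫ ω₃ (curl W)₃`, `E = ∫|∇v|²_F`, `G = ∫ω₃²`, `N = ‖∇v₃‖_{L^r}`, `q = 4r/(3r-6)`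
(the two balances `integral_sum_inner_fderiv_le_oneComponent`, `integral_curl_two_mul_curl_two_le`,
the slice bounds, and `oneComponent_slice_algebra`).
[cite: LemarieRieusset2016, §11.5 Prop. 11.5 proof, (11.26)–(11.30) (PDF pp. 355–356)] -/
theorem oneComponent_slice_le {ν : ℝ} (hν : 0 < ν) {r : ℝ} (hr2 : 2 < r) (hr6 : r ≤ 6) :
    ∃ C : ℝ, 0 ≤ C ∧
      ∀ (v W : (EuclideanSpace ℝ (Fin 3)) → (EuclideanSpace ℝ (Fin 3)))
        (q : (EuclideanSpace ℝ (Fin 3)) → ℝ) (B B₁ B₂ : ℝ),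
        ContDiff ℝ ∞ v → ContDiff ℝ 1 W → ContDiff ℝ 1 q →
        (∀ x, W x + FluidPDE.convect v v x = ν • (Δ v) x - gradient q x) →
        (∀ x, curl W x = ν • (Δ (curl v)) x - FluidPDE.convect v (curl v) x +
          FluidPDE.convect (curl v) v x) →
        VectorCalculus.IsDivFree v →
        (∀ x, ‖v x‖ ≤ B) → (∀ x, ‖fderiv ℝ v x‖ ≤ B₁) → (∀ x, ‖iteratedFDeriv ℝ 2 v x‖ ≤ B₂) →
        ∫⁻ x, ‖v x‖ₑ ^ 2 < ⊤ → ∫⁻ x, ‖iteratedFDeriv ℝ 1 v x‖ₑ ^ 2 < ⊤ →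
        ∫⁻ x, ‖iteratedFDeriv ℝ 2 v x‖ₑ ^ 2 < ⊤ → ∫⁻ x, ‖iteratedFDeriv ℝ 3 v x‖ₑ ^ 2 < ⊤ →
        ∫⁻ x, ‖W x‖ₑ ^ 2 < ⊤ → ∫⁻ x, ‖iteratedFDeriv ℝ 1 W x‖ₑ ^ 2 < ⊤ →
        ∫⁻ x, ‖q x‖ₑ ^ 2 < ⊤ → ∫⁻ x, ‖iteratedFDeriv ℝ 1 q x‖ₑ ^ 2 < ⊤ →
        ∫⁻ x, ENNReal.ofReal ‖fderiv ℝ (fun y => v y 2) x‖ ^ r < ⊤ →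
        (∫ x, ∑ i, ⟪fderiv ℝ v x (EuclideanSpace.basisFun (Fin 3) ℝ i),
            fderiv ℝ W x (EuclideanSpace.basisFun (Fin 3) ℝ i)⟫) +
          2 * (∫ x, (curl v x 2) ^ 2) * (∫ x, curl v x 2 * curl W x 2) ≤
        C * (1 + ((∫⁻ x, ENNReal.ofReal ‖fderiv ℝ (fun y => v y 2) x‖ ^ r) ^ (1 / r)).toReal ^
              (4 * r / (3 * r - 6)) + ∫ x, FluidPDE.frobeniusNormSq (fderiv ℝ v x)) *
          (1 + (∫ x, FluidPDE.frobeniusNormSq (fderiv ℝ v x)) + (∫ x, (curl v x 2) ^ 2) ^ 2) := by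
  set e := EuclideanSpace.basisFun (Fin 3) ℝ with he
  have he1 : ∀ i, ‖e i‖ = 1 := fun i => by simp [he]
  set K : ℝ≥0 := SNormLESNormFDerivOfEqConst (EuclideanSpace ℝ (Fin 3))
    (volume : Measure (EuclideanSpace ℝ (Fin 3))) 2 with hK
  set K₃ : ℝ≥0 := SNormLESNormFDerivOfEqConst ℝ (volume : Measure (EuclideanSpace ℝ (Fin 3))) 2
    with hK₃
  set κ : ℝ := ‖(curlCLM : ((EuclideanSpace ℝ (Fin 3)) →L[ℝ] (EuclideanSpace ℝ (Fin 3))) →L[ℝ]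
    (EuclideanSpace ℝ (Fin 3)))‖ with hκ
  have hκ0 : 0 ≤ κ := norm_nonneg (curlCLM : ((EuclideanSpace ℝ (Fin 3)) →L[ℝ]
    (EuclideanSpace ℝ (Fin 3))) →L[ℝ] (EuclideanSpace ℝ (Fin 3)))
  -- the exponents
  have hr0 : 0 < r := by linarith only [hr2]
  have hr2' : 0 < r - 2 := by linarith only [hr2]
  have h2r3 : 0 < 2 * r - 3 := by linarith only [hr2]
  have h3r6 : 0 < 3 * r - 6 := by linarith only [hr2]
  have hr2p : 0 < r + 2 := by linarith only [hr2]
  have hr0' : r ≠ 0 := hr0.ne'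
  have hr2'' : r - 2 ≠ 0 := hr2'.ne'
  have h2r3' : 2 * r - 3 ≠ 0 := h2r3.ne'
  have h3r6' : 3 * r - 6 ≠ 0 := h3r6.ne'
  have hr2p' : r + 2 ≠ 0 := hr2p.ne'
  obtain ⟨pq, hpq⟩ : ∃ pq : ℝ, pq = 4 * r / (3 * r - 6) := ⟨_, rfl⟩
  have hpq0 : 0 ≤ pq := by rw [hpq]; positivity
  obtain ⟨ρ, hρ⟩ : ∃ ρ : ℝ, ρ = 4 * r / (r + 2) := ⟨_, rfl⟩
  have hρ0 : 0 < ρ := by rw [hρ]; positivity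
  have hρ2 : 2 ≤ ρ := by rw [hρ, le_div_iff₀ hr2p]; linarith only [hr2]
  have hρr : ρ ≤ r := by rw [hρ, div_le_iff₀ hr2p]; nlinarith only [hr2]
  obtain ⟨σ, hσ⟩ : ∃ σ : ℝ, σ = 4 * r / (r - 2) := ⟨_, rfl⟩
  have hσ6 : 6 ≤ σ := by rw [hσ, le_div_iff₀ hr2']; linarith only [hr6]
  have hρσ : 1 / ρ + 1 / σ + 1 / 2 = 1 := by
    rw [hρ, hσ]
    field_simp
    ring
  obtain ⟨s, hs⟩ : ∃ s : ℝ, s = 3 * r / (2 * r - 3) := ⟨_, rfl⟩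
  have h2s : 2 ≤ s := by rw [hs, le_div_iff₀ h2r3]; linarith only [hr6]
  have hs6 : s ≤ 6 := by rw [hs, div_le_iff₀ h2r3]; linarith only [hr2]
  have hrs : 1 / r + 1 / s + 1 / 3 = 1 := by
    rw [hs]
    field_simp
    ring
  -- the constant
  obtain ⟨C, hC0, hC⟩ := oneComponent_slice_algebra hν hr2 hr6 (K := (K : ℝ)) (K₃ := (K₃ : ℝ))
    (KA := agmonConst) (κ := κ) K.coe_nonneg K₃.coe_nonneg agmonConst_nonneg hκ0 hσ hs
  have h9q : (1 : ℝ) ≤ (9 : ℝ) ^ pq := Real.one_le_rpow (by norm_num) hpq0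
  refine ⟨C * (9 : ℝ) ^ pq, by positivity, ?_⟩
  intro v W q B B₁ B₂ hv hW hq hmom hcurlW hdiv hB hB₁ hB₂ hv0 hv1 hv2 hv3 hW0 hW1 hq0 hq1 hFr
  rw [← hpq]
  have hB0 : 0 ≤ B := (norm_nonneg _).trans (hB 0)
  have hB₁0 : 0 ≤ B₁ := (norm_nonneg _).trans (hB₁ 0)
  have hv1c : ContDiff ℝ 1 v := hv.of_le (by norm_cast)
  have hv2c : ContDiff ℝ 2 v := hv.of_le (by norm_cast)
  have hv3c : ContDiff ℝ 3 v := hv.of_le (by norm_cast)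
  have hdv : ∀ x, DifferentiableAt ℝ v x := fun x => (hv1c.differentiable one_ne_zero) x
  -- the weight `F = |∇v₃|`
  obtain ⟨F, hF⟩ : ∃ F : (EuclideanSpace ℝ (Fin 3)) → ℝ, F = fun x => ‖fderiv ℝ (fun y => v y 2) x‖ :=
    ⟨_, rfl⟩
  have hFx : ∀ x, F x = ‖fderiv ℝ (fun y => v y 2) x‖ := fun x => by rw [hF]
  have hF0 : ∀ x, 0 ≤ F x := fun x => by rw [hFx]; exact norm_nonneg _
  have hu2 : ContDiff ℝ 1 (fun y => v y 2) := contDiff_apply_coord hv1c 2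
  have hFc : Continuous F := by rw [hF]; exact (hu2.continuous_fderiv one_ne_zero).norm
  have hFle : ∀ x, F x ≤ ‖fderiv ℝ v x‖ := by
    intro x
    rw [hFx]
    refine ContinuousLinearMap.opNorm_le_bound _ (norm_nonneg _) fun h => ?_
    calc ‖fderiv ℝ (fun y => v y 2) x h‖ = ‖fderiv ℝ v x h 2‖ := by
          rw [fderiv_apply_coord (hdv x) h 2]
      _ ≤ ‖fderiv ℝ v x h‖ := PiLp.norm_apply_le _ 2
      _ ≤ ‖fderiv ℝ v x‖ * ‖h‖ := (fderiv ℝ v x).le_opNorm h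
  have hFB : ∀ x, F x ≤ B₁ := fun x => (hFle x).trans (hB₁ x)
  have hDv_eq : ∀ x, ‖fderiv ℝ v x‖ = ‖iteratedFDeriv ℝ 1 v x‖ := fun x => by
    rw [← norm_iteratedFDeriv_fderiv, norm_iteratedFDeriv_zero]
  have hFle1 : ∀ x, F x ≤ ‖iteratedFDeriv ℝ 1 v x‖ := fun x => (hFle x).trans_eq (hDv_eq x)
  have hFr' : ∫⁻ x, ENNReal.ofReal (F x) ^ r < ⊤ := by simpa only [hFx] using hFr
  -- the real quantities
  have cDv : Continuous (fderiv ℝ v) := hv1c.continuous_fderiv one_ne_zero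
  have cvs : ∀ j, Continuous fun x => fderiv ℝ v x (e j) := fun j => cDv.clm_apply continuous_const
  have l2vs : ∀ j, ∫⁻ x, ‖fderiv ℝ v x (e j)‖ₑ ^ 2 < ⊤ := fun j =>
    lintegral_enorm_sq_lt_top_of_norm_le (fun x => norm_fderiv_apply_basisFun_le v x j) hv1
  have i_sq : ∀ j, Integrable (fun x => ‖fderiv ℝ v x (e j)‖ ^ 2) volume := fun j =>
    FluidPDE.integrable_sq_norm_of_lintegral_lt_top (cvs j) (l2vs j)
  have i_E : Integrable (fun x => ∑ j, ‖fderiv ℝ v x (e j)‖ ^ 2) volume :=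
    integrable_finsetSum _ fun j _ => i_sq j
  obtain ⟨E, hE⟩ : ∃ E : ℝ, E = ∫ x, ∑ j, ‖fderiv ℝ v x (e j)‖ ^ 2 := ⟨_, rfl⟩
  have hE0 : 0 ≤ E := by rw [hE]; exact integral_nonneg fun x => Finset.sum_nonneg fun j _ => sq_nonneg _
  have hEfrob : ∫ x, FluidPDE.frobeniusNormSq (fderiv ℝ v x) = E := by
    rw [hE]
    exact integral_congr_ae (Eventually.of_forall fun x => FluidPDE.frobeniusNormSq_eq_sum e _)
  rw [hEfrob]
  obtain ⟨A, hA⟩ : ∃ A : ℝ, A = ∫ x, ‖(Δ v) x‖ ^ 2 := ⟨_, rfl⟩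
  have hA0 : 0 ≤ A := by rw [hA]; exact integral_nonneg fun x => sq_nonneg _
  obtain ⟨G, hG⟩ : ∃ G : ℝ, G = ∫ x, (curl v x 2) ^ 2 := ⟨_, rfl⟩
  have hG0 : 0 ≤ G := by rw [hG]; exact integral_nonneg fun x => sq_nonneg _
  rw [← hG]
  obtain ⟨P, hP⟩ : ∃ P : ℝ, P = ∫ x, ∑ i, (fderiv ℝ (fun y => curl v y 2) x (e i)) ^ 2 := ⟨_, rfl⟩
  have hP0 : 0 ≤ P := by
    rw [hP]; exact integral_nonneg fun x => Finset.sum_nonneg fun i _ => sq_nonneg _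
  obtain ⟨N, hN⟩ : ∃ N : ℝ, N = ((∫⁻ x, ENNReal.ofReal (F x) ^ r) ^ (1 / r)).toReal := ⟨_, rfl⟩
  have hN0 : 0 ≤ N := by rw [hN]; exact ENNReal.toReal_nonneg
  have hNF : ((∫⁻ x, ENNReal.ofReal ‖fderiv ℝ (fun y => v y 2) x‖ ^ r) ^ (1 / r)).toReal = N := by
    rw [hN]; simp only [hFx]
  rw [hNF]
  obtain ⟨a, ha⟩ : ∃ a : Fin 3 → ℝ, a = fun j => ∫ x, ‖fderiv ℝ v x (e j)‖ ^ 2 := ⟨_, rfl⟩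
  obtain ⟨R, hR⟩ : ∃ R : Fin 3 → ℝ, R = fun j =>
    ∑ i, ∫ x, ‖fderiv ℝ (fun y => fderiv ℝ v y (e j)) x (e i)‖ ^ 2 := ⟨_, rfl⟩
  have ha0 : ∀ j, 0 ≤ a j := fun j => by rw [ha]; exact integral_nonneg fun x => sq_nonneg _
  have hR0 : ∀ j, 0 ≤ R j := fun j => by
    rw [hR]; exact Finset.sum_nonneg fun i _ => integral_nonneg fun x => sq_nonneg _
  have haE : ∑ j, a j = E := by
    rw [ha, hE, integral_finsetSum _ fun j _ => i_sq j]
  have hRA : ∑ j, R j = A := by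
    rw [hR, hA]
    exact sum_sum_integral_sq_norm_fderiv_fderiv_eq_integral_sq_norm_laplacian hv3c hv1 hv2 hv3
  -- ### the two balances
  have hRI := integral_sum_inner_fderiv_le_oneComponent hv3c hW hq hmom hdiv hB hB₁ hB₂ hv0 hv1 hv2
    hv3 hW0 hW1 hq0 hq1
  have hRG := integral_curl_two_mul_curl_two_le hv3c hdiv hB hB₁ hcurlW hv1 hv2 hv3
  rw [← hA] at hRI
  rw [← hP] at hRG
  -- ### the four production terms
  -- (c) `∫ F |∇v|²_F = Σⱼ ∫ F ‖∂ⱼv‖²` and the weighted key estimate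
  have i_Fsq : ∀ j, Integrable (fun x => F x * ‖fderiv ℝ v x (e j)‖ ^ 2) volume := by
    intro j
    refine ((i_sq j).const_mul B₁).mono' ((hFc.mul ((cvs j).norm.pow 2)).aestronglyMeasurable)
      (Eventually.of_forall fun x => ?_)
    rw [Real.norm_of_nonneg (mul_nonneg (hF0 x) (sq_nonneg _))]
    exact mul_le_mul_of_nonneg_right (hFB x) (sq_nonneg _)
  have hTc_eq : ∫ x, ‖fderiv ℝ (fun y => v y 2) x‖ * FluidPDE.frobeniusNormSq (fderiv ℝ v x) =
      ∑ j, ∫ x, F x * ‖fderiv ℝ v x (e j)‖ ^ 2 := by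
    rw [← integral_finsetSum _ fun j _ => i_Fsq j]
    refine integral_congr_ae (Eventually.of_forall fun x => ?_)
    simp only [hFx]
    rw [FluidPDE.frobeniusNormSq_eq_sum e, Finset.mul_sum]
  have hr32 : 3 / 2 < r := by linarith only [hr2]
  have hTc : ∫ x, ‖fderiv ℝ (fun y => v y 2) x‖ * FluidPDE.frobeniusNormSq (fderiv ℝ v x) ≤
      ∑ j, (9 * N) * a j ^ (1 - 3 / (2 * r)) * ((K : ℝ) ^ 2 * R j) ^ (3 / (2 * r)) := by
    rw [hTc_eq]
    refine Finset.sum_le_sum fun j _ => ?_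
    have hM := integral_weight_mul_sq_norm_fderiv_apply_le hv3c hv1 hv2 hFc hF0 hFB hr32 hFr' j
    rw [← hN] at hM
    have haj : a j = ∫ x, ‖fderiv ℝ v x (e j)‖ ^ 2 := by rw [ha]
    have hRj : R j = ∑ i, ∫ x, ‖fderiv ℝ (fun y => fderiv ℝ v y (e j)) x (e i)‖ ^ 2 := by rw [hR]
    rw [haj, hRj]
    refine hM.trans ?_
    have h9 : N ≤ 9 * N := by linarith only [hN0]
    exact mul_le_mul_of_nonneg_right (mul_le_mul_of_nonneg_right h9 (Real.rpow_nonneg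
      (integral_nonneg fun x => sq_nonneg _) _)) (Real.rpow_nonneg (mul_nonneg (sq_nonneg _)
        (Finset.sum_nonneg fun i _ => integral_nonneg fun x => sq_nonneg _)) _)
  -- (b) `∫ F |v| Σⱼ ‖D∂ⱼv‖ ≤ 3 ∫ F |v| ‖D²v‖` and the Hessian bound
  have cD2 : Continuous fun x => iteratedFDeriv ℝ 2 v x := hv.continuous_iteratedFDeriv (m := 2) (by norm_cast)
  have cv : Continuous v := hv.continuous
  have n_Dvs : ∀ j x, ‖fderiv ℝ (fun y => fderiv ℝ v y (e j)) x‖ ≤ ‖iteratedFDeriv ℝ 2 v x‖ := by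
    intro j x
    rw [← norm_iteratedFDeriv_zero (𝕜 := ℝ) (f := fderiv ℝ (fun y => fderiv ℝ v y (e j))) (x := x),
      norm_iteratedFDeriv_fderiv]
    exact norm_iteratedFDeriv_fderiv_apply_basisFun_le hv3c 1 (by norm_num) x j
  have i_b : Integrable (fun x => F x * ‖v x‖ * ‖iteratedFDeriv ℝ 2 v x‖) volume := by
    refine integrable_of_norm_le_mul_of_lintegral_sq (a := fun x => B • iteratedFDeriv ℝ 1 v x)
      (b := fun x => iteratedFDeriv ℝ 2 v x) ((hFc.mul cv.norm).mul cD2.norm).aestronglyMeasurable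
      ((hv.continuous_iteratedFDeriv (m := 1) (by norm_cast)).const_smul B) cD2
      (lintegral_enorm_sq_const_smul_lt_top B hv1) hv2 fun x => ?_
    rw [Real.norm_of_nonneg (mul_nonneg (mul_nonneg (hF0 x) (norm_nonneg _)) (norm_nonneg _)),
      norm_smul, Real.norm_of_nonneg hB0]
    have h1 := hFle1 x
    have h2 := hB x
    have h3 : F x * ‖v x‖ ≤ B * ‖iteratedFDeriv ℝ 1 v x‖ := by
      calc F x * ‖v x‖ ≤ ‖iteratedFDeriv ℝ 1 v x‖ * B :=
            mul_le_mul h1 h2 (norm_nonneg _) (norm_nonneg _)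
        _ = B * ‖iteratedFDeriv ℝ 1 v x‖ := mul_comm _ _
    exact mul_le_mul_of_nonneg_right h3 (norm_nonneg _)
  have hTb1 : ∫ x, ‖fderiv ℝ (fun y => v y 2) x‖ * ‖v x‖ *
        ∑ j, ‖fderiv ℝ (fun y => fderiv ℝ v y (e j)) x‖ ≤
      3 * ∫ x, F x * ‖v x‖ * ‖iteratedFDeriv ℝ 2 v x‖ := by
    rw [← integral_const_mul]
    refine integral_mono_of_nonneg (Eventually.of_forall fun x => ?_) (i_b.const_mul 3)
      (Eventually.of_forall fun x => ?_)
    · exact mul_nonneg (mul_nonneg (norm_nonneg _) (norm_nonneg _))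
        (Finset.sum_nonneg fun j _ => norm_nonneg _)
    · have hs3 : ∑ j, ‖fderiv ℝ (fun y => fderiv ℝ v y (e j)) x‖ ≤ 3 * ‖iteratedFDeriv ℝ 2 v x‖ := by
        calc ∑ j, ‖fderiv ℝ (fun y => fderiv ℝ v y (e j)) x‖ ≤ ∑ _j : Fin 3, ‖iteratedFDeriv ℝ 2 v x‖ :=
              Finset.sum_le_sum fun j _ => n_Dvs j x
          _ = 3 * ‖iteratedFDeriv ℝ 2 v x‖ := by
              simp only [Finset.sum_const, Finset.card_univ, Fintype.card_fin, nsmul_eq_mul]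
              push_cast; ring
      show ‖fderiv ℝ (fun y => v y 2) x‖ * ‖v x‖ * ∑ j, ‖fderiv ℝ (fun y => fderiv ℝ v y (e j)) x‖ ≤
        3 * (F x * ‖v x‖ * ‖iteratedFDeriv ℝ 2 v x‖)
      rw [← hFx]
      calc F x * ‖v x‖ * ∑ j, ‖fderiv ℝ (fun y => fderiv ℝ v y (e j)) x‖
          ≤ F x * ‖v x‖ * (3 * ‖iteratedFDeriv ℝ 2 v x‖) :=
            mul_le_mul_of_nonneg_left hs3 (mul_nonneg (hF0 x) (norm_nonneg _))
        _ = 3 * (F x * ‖v x‖ * ‖iteratedFDeriv ℝ 2 v x‖) := by ring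
  -- `‖F‖_ρ ≤ ‖F‖₂^{1/2} ‖F‖_r^{1/2} ≤ E^{1/4} N^{1/2}` (interpolation, `2 ≤ ρ ≤ r`)
  have hFm : AEMeasurable (fun x => ENNReal.ofReal (F x)) volume :=
    hFc.measurable.ennreal_ofReal.aemeasurable
  have hI2 : ∫⁻ x, ENNReal.ofReal (F x) ^ (2 : ℝ) ≤ ENNReal.ofReal E := by
    rw [hE, ofReal_integral_eq_lintegral_ofReal i_E
      (Eventually.of_forall fun x => Finset.sum_nonneg fun j _ => sq_nonneg _)]
    refine lintegral_mono fun x => ?_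
    rw [ENNReal.ofReal_rpow_of_nonneg (hF0 x) (by norm_num : (0:ℝ) ≤ 2), Real.rpow_two]
    refine ENNReal.ofReal_le_ofReal ?_
    calc F x ^ 2 ≤ ‖fderiv ℝ v x‖ ^ 2 := pow_le_pow_left₀ (hF0 x) (hFle x) 2
      _ ≤ ∑ j, ‖fderiv ℝ v x (e j)‖ ^ 2 := FluidPDE.sq_opNorm_le_sum_sq_norm_apply e (fderiv ℝ v x)
  have hIρ : ∫⁻ x, ENNReal.ofReal (F x) ^ ρ ≤
      (∫⁻ x, ENNReal.ofReal (F x) ^ (2 : ℝ)) ^ ((r - ρ) / (r - 2)) *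
        (∫⁻ x, ENNReal.ofReal (F x) ^ r) ^ ((ρ - 2) / (r - 2)) :=
    lintegral_rpow_interpolate hFm zero_lt_two hr2 hρ2 hρr
  have hexp1 : 0 ≤ (r - ρ) / (r - 2) := div_nonneg (by linarith only [hρr]) hr2'.le
  have hexp2 : 0 ≤ (ρ - 2) / (r - 2) := div_nonneg (by linarith only [hρ2]) hr2'.le
  have hFρ : ∫⁻ x, ENNReal.ofReal (F x) ^ ρ < ⊤ := by
    refine lt_of_le_of_lt hIρ (ENNReal.mul_lt_top ?_ ?_)
    · exact ENNReal.rpow_lt_top_of_nonneg hexp1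
        (ne_top_of_le_ne_top ENNReal.ofReal_ne_top hI2)
    · exact ENNReal.rpow_lt_top_of_nonneg hexp2 hFr'.ne
  obtain ⟨N₀, hN₀⟩ : ∃ N₀ : ℝ, N₀ = ((∫⁻ x, ENNReal.ofReal (F x) ^ ρ) ^ (1 / ρ)).toReal := ⟨_, rfl⟩
  have hN₀0 : 0 ≤ N₀ := by rw [hN₀]; exact ENNReal.toReal_nonneg
  have he14 : (r - ρ) / (r - 2) * (1 / ρ) = 1 / 4 := by
    rw [hρ]
    field_simp
    ring
  have he12 : (ρ - 2) / (r - 2) * (1 / ρ) = 1 / r * (1 / 2) := by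
    rw [hρ]
    field_simp
    ring
  have hN₀le : N₀ ≤ E ^ (1 / 4 : ℝ) * N ^ (1 / 2 : ℝ) := by
    have h1 : (∫⁻ x, ENNReal.ofReal (F x) ^ ρ) ^ (1 / ρ) ≤
        ENNReal.ofReal E ^ (1 / 4 : ℝ) * ((∫⁻ x, ENNReal.ofReal (F x) ^ r) ^ (1 / r)) ^ (1 / 2 : ℝ) := by
      calc (∫⁻ x, ENNReal.ofReal (F x) ^ ρ) ^ (1 / ρ)
          ≤ ((∫⁻ x, ENNReal.ofReal (F x) ^ (2 : ℝ)) ^ ((r - ρ) / (r - 2)) *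
              (∫⁻ x, ENNReal.ofReal (F x) ^ r) ^ ((ρ - 2) / (r - 2))) ^ (1 / ρ) :=
            ENNReal.rpow_le_rpow hIρ (by positivity)
        _ = (∫⁻ x, ENNReal.ofReal (F x) ^ (2 : ℝ)) ^ (1 / 4 : ℝ) *
              ((∫⁻ x, ENNReal.ofReal (F x) ^ r) ^ (1 / r)) ^ (1 / 2 : ℝ) := by
            rw [ENNReal.mul_rpow_of_nonneg _ _ (by positivity), ← ENNReal.rpow_mul,
              ← ENNReal.rpow_mul, ← ENNReal.rpow_mul, he14, he12]
        _ ≤ ENNReal.ofReal E ^ (1 / 4 : ℝ) * ((∫⁻ x, ENNReal.ofReal (F x) ^ r) ^ (1 / r)) ^ (1 / 2 : ℝ) := by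
            gcongr
    have hfin : ENNReal.ofReal E ^ (1 / 4 : ℝ) *
        ((∫⁻ x, ENNReal.ofReal (F x) ^ r) ^ (1 / r)) ^ (1 / 2 : ℝ) ≠ ⊤ :=
      ENNReal.mul_ne_top (ENNReal.rpow_ne_top_of_nonneg (by norm_num) ENNReal.ofReal_ne_top)
        (ENNReal.rpow_ne_top_of_nonneg (by norm_num)
          (ENNReal.rpow_ne_top_of_nonneg (by positivity) hFr'.ne))
    have h2 := ENNReal.toReal_mono hfin h1
    have hR : (ENNReal.ofReal E ^ (1 / 4 : ℝ) *
        ((∫⁻ x, ENNReal.ofReal (F x) ^ r) ^ (1 / r)) ^ (1 / 2 : ℝ)).toReal = E ^ (1 / 4 : ℝ) * N ^ (1 / 2 : ℝ) := by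
      rw [ENNReal.toReal_mul, ← ENNReal.toReal_rpow, ← ENNReal.toReal_rpow, ENNReal.toReal_ofReal hE0,
        ← hN]
    rw [hR] at h2
    rw [hN₀]
    exact h2
  -- the Hessian term
  have hTbB := integral_weight_mul_norm_mul_hessian_le hv hv0 hv1 hv2 hv3 hFc hF0 hFB hρ0 hσ6 hρσ hFρ
  rw [← hN₀, ← hE, ← hA] at hTbB
  have hTb : 3 * ∫ x, F x * ‖v x‖ * ‖iteratedFDeriv ℝ 2 v x‖ ≤
      (3 * N₀) * ((agmonConst * (E * A) ^ (1 / 4 : ℝ)) ^ ((σ - 6) / σ) *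
        ((K : ℝ) * E ^ (1 / 2 : ℝ)) ^ (6 / σ)) * (27 * A) ^ (1 / 2 : ℝ) := by
    have := mul_le_mul_of_nonneg_left hTbB (by norm_num : (0:ℝ) ≤ 3)
    linarith only [this]
  have hN₀le' : 3 * N₀ ≤ E ^ (1 / 4 : ℝ) * (9 * N) ^ (1 / 2 : ℝ) := by
    have h9 : (9 * N) ^ (1 / 2 : ℝ) = 3 * N ^ (1 / 2 : ℝ) := by
      rw [Real.mul_rpow (by norm_num) hN0, show (9 : ℝ) = 3 ^ (2 : ℝ) by norm_num,
        ← Real.rpow_mul (by norm_num)]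
      norm_num
    rw [h9]
    nlinarith only [hN₀le, Real.rpow_nonneg hE0 (1 / 4 : ℝ)]
  -- (d) the `ω₃`-term
  have hTd := integral_laplacian_mul_norm_mul_curl_two_le hv hB hv0 hv1 hv2
  rw [← hG, ← hP, ← hE, ← hA] at hTd
  -- (J) the right-hand side of the `ω₃`-balance
  have hs0 : 0 < s := by linarith only [h2s]
  have hTJ0 := integral_curl_two_mul_curl_mul_weight_le hv hv1 hv2 hv3 hFc hF0 hFB hr0 h2s hs6 hrs hFr'
  rw [← hN, ← hG, ← hP, ← hE, ← hA] at hTJ0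
  have hTJfac : 0 ≤ (G ^ ((6 - s) / (6 - 2)) *
      ((((K₃ : ℝ)) * P ^ (1 / 2 : ℝ)) ^ (6 : ℝ)) ^ ((s - 2) / (6 - 2))) ^ (1 / s) *
      ((κ ^ 2 * E) ^ ((6 - 3) / (6 - 2) : ℝ) *
        ((((K : ℝ)) * (κ ^ 2 * (27 * A)) ^ (1 / 2 : ℝ)) ^ (6 : ℝ)) ^ ((3 - 2) / (6 - 2) : ℝ)) ^
          (1 / 3 : ℝ) := by
    refine mul_nonneg (Real.rpow_nonneg (mul_nonneg (Real.rpow_nonneg hG0 _)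
      (Real.rpow_nonneg (Real.rpow_nonneg (mul_nonneg K₃.coe_nonneg (Real.rpow_nonneg hP0 _)) _) _)) _)
      (Real.rpow_nonneg (mul_nonneg (Real.rpow_nonneg (mul_nonneg (sq_nonneg _) hE0) _)
        (Real.rpow_nonneg (Real.rpow_nonneg (mul_nonneg K.coe_nonneg (Real.rpow_nonneg
          (mul_nonneg (sq_nonneg _) (by positivity)) _)) _) _)) _)
  have hTJ : ∫ x, |curl v x 2| * ‖curl v x‖ * F x ≤
      (9 * N) * (G ^ ((6 - s) / (6 - 2)) *
        ((((K₃ : ℝ)) * P ^ (1 / 2 : ℝ)) ^ (6 : ℝ)) ^ ((s - 2) / (6 - 2))) ^ (1 / s) *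
      ((κ ^ 2 * E) ^ ((6 - 3) / (6 - 2) : ℝ) *
        ((((K : ℝ)) * (κ ^ 2 * (27 * A)) ^ (1 / 2 : ℝ)) ^ (6 : ℝ)) ^ ((3 - 2) / (6 - 2) : ℝ)) ^
          (1 / 3 : ℝ) := by
    refine hTJ0.trans ?_
    rw [mul_assoc, mul_assoc (9 * N)]
    exact mul_le_mul_of_nonneg_right (by linarith only [hN0]) hTJfac
  -- ### the balances in the bookkeeping form
  have hTc0 : 0 ≤ ∫ x, ‖fderiv ℝ (fun y => v y 2) x‖ * FluidPDE.frobeniusNormSq (fderiv ℝ v x) :=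
    integral_nonneg fun x => mul_nonneg (norm_nonneg _) (FluidPDE.frobeniusNormSq_nonneg _)
  have hRI' : ∫ x, ∑ i, ⟪fderiv ℝ v x (e i), fderiv ℝ W x (e i)⟫ ≤
      -ν * A + (5 / 2 + 8 * κ) *
          (∫ x, ‖fderiv ℝ (fun y => v y 2) x‖ * FluidPDE.frobeniusNormSq (fderiv ℝ v x)) +
        2 * κ * (3 * ∫ x, F x * ‖v x‖ * ‖iteratedFDeriv ℝ 2 v x‖) +
        2 * ∫ x, ‖(Δ v) x‖ * ‖v x‖ * |curl v x 2| := by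
    have h := mul_le_mul_of_nonneg_left hTb1 (by positivity : (0:ℝ) ≤ 2 * κ)
    linarith only [hRI, h]
  have hRGF : ∫ x, |curl v x 2| * ‖curl v x‖ * ‖fderiv ℝ (fun y => v y 2) x‖ =
      ∫ x, |curl v x 2| * ‖curl v x‖ * F x := by simp only [hFx]
  rw [hRGF] at hRG
  -- ### the bookkeeping
  have h9N : 0 ≤ 9 * N := by positivity
  have key := hC (9 * N) (3 * N₀) E A G P
    (∫ x, ‖fderiv ℝ (fun y => v y 2) x‖ * FluidPDE.frobeniusNormSq (fderiv ℝ v x))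
    (3 * ∫ x, F x * ‖v x‖ * ‖iteratedFDeriv ℝ 2 v x‖)
    (∫ x, ‖(Δ v) x‖ * ‖v x‖ * |curl v x 2|) (∫ x, |curl v x 2| * ‖curl v x‖ * F x)
    (∫ x, ∑ i, ⟪fderiv ℝ v x (e i), fderiv ℝ W x (e i)⟫) (∫ x, curl v x 2 * curl W x 2) a R
    h9N (by positivity) hE0 hA0 hG0 hP0 ha0 hR0 haE hRA hRI' hRG hTc hN₀le' hTb hTd hTJ
  -- `(9N)^q = 9^q N^q`
  have h9pow : (9 * N) ^ pq = (9 : ℝ) ^ pq * N ^ pq := Real.mul_rpow (by norm_num) hN0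
  rw [← hpq, h9pow] at key
  have hW : C * (1 + (9 : ℝ) ^ pq * N ^ pq + E) ≤ C * (9 : ℝ) ^ pq * (1 + N ^ pq + E) := by
    have hNq : 0 ≤ N ^ pq := Real.rpow_nonneg hN0 _
    have : 1 + (9 : ℝ) ^ pq * N ^ pq + E ≤ (9 : ℝ) ^ pq * (1 + N ^ pq + E) := by
      nlinarith only [h9q, hNq, hE0]
    nlinarith only [this, hC0]
  have hKf : 0 ≤ 1 + E + G ^ 2 := by positivity
  calc (∫ x, ∑ i, ⟪fderiv ℝ v x (e i), fderiv ℝ W x (e i)⟫) + 2 * G * ∫ x, curl v x 2 * curl W x 2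
      ≤ C * (1 + (9 : ℝ) ^ pq * N ^ pq + E) * (1 + E + G ^ 2) := key
    _ ≤ C * (9 : ℝ) ^ pq * (1 + N ^ pq + E) * (1 + E + G ^ 2) :=
        mul_le_mul_of_nonneg_right hW hKf

end Slice

end Literature.Analysis.FluidPDE
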